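import Literature.Topology.PlanarFoliations.LeafOrder
import HarnessLib

/-!
# Loops in open leaves are null-homotopic

Topic: Topology / PlanarFoliations, sequel to `LeafOrder.lean` (the nested line charts of an open
leaf of a bi-oriented planar foliation: arc charts onto the whole real line exhausting the leaf).
**Every loop of an open leaf (in its leaf topology) is homotopic to the constant loop**
(`homotopic_refl_of_noncompactSpace`): its compact image lies in the source of one line chart
(`exists_subset_lineCharts_source`), where the straight-line contraction of the real line pulls
back to a homotopy with fixed ends. (Open leaves are lines, hence simply connected in their leaf
topology.) Consequently the planar images of the loops tracked along an open leaf have winding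
number `0` about the points off the leaf.

All statements are [folklore].
-/

noncomputable section

open Set Filter Function unitInterval
open _root_.Topology
open Literature.Topology.FourManifolds Literature.Topology.FourManifolds.Foliation
  Literature.Topology.FourManifolds.OneManifold

namespace Literature.Topology.PlanarFoliations

variable {X : Type*} [TopologicalSpace X] [T2Space X] [SecondCountableTopology X] {F : Foliation ℝ X} {x : X}
variable [NoncompactSpace (F.Leaf x)]

/-- **Loops of an open leaf are null-homotopic in the leaf topology.** [folklore] -/
theorem homotopic_refl_of_noncompactSpace (hbi : IsBiOriented F) {p : F.Leaf x} (c : Path p p) :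
    c.Homotopic (Path.refl p) := by
  -- the image of the loop lies in one line chart
  obtain ⟨n, hn⟩ := exists_subset_lineCharts_source (hbi := hbi) (isCompact_range c.continuous)
  set e := lineCharts hbi x n with he
  have htgt : e.target = univ := lineCharts_target hbi n
  have hmem : ∀ t, c t ∈ e.source := fun t ↦ hn ⟨t, rfl⟩
  have hp : p ∈ e.source := by rw [← c.source]; exact hmem 0
  have hsymm : Continuous e.symm := arc_continuous_symm htgt
  have hec : Continuous fun t : I ↦ e (c t) := e.continuousOn.comp_continuous c.continuous hmem
  -- the straight-line contraction in the chart, pulled back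
  refine ⟨{ toFun := fun q ↦ e.symm ((1 - (q.1 : ℝ)) * e (c q.2) + (q.1 : ℝ) * e p)
            continuous_toFun := ?_
            map_zero_left := fun t ↦ ?_
            map_one_left := fun t ↦ ?_
            prop' := fun r t ht ↦ ?_ }⟩
  · refine hsymm.comp ?_
    have hr : Continuous fun q : I × I ↦ ((q.1 : I) : ℝ) := continuous_subtype_val.comp continuous_fst
    exact ((continuous_const.sub hr).mul (hec.comp continuous_snd)).add (hr.mul continuous_const)
  · show e.symm ((1 - (0 : ℝ)) * e (c t) + (0 : ℝ) * e p) = c t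
    rw [sub_zero, one_mul, zero_mul, add_zero, e.left_inv (hmem t)]
  · show e.symm ((1 - (1 : ℝ)) * e (c t) + (1 : ℝ) * e p) = (Path.refl p) t
    rw [sub_self, zero_mul, one_mul, zero_add, e.left_inv hp]; rfl
  · show e.symm ((1 - (r : ℝ)) * e (c t) + (r : ℝ) * e p) = c t
    rcases ht with rfl | rfl
    · rw [c.source]
      rw [show (1 - (r : ℝ)) * e p + (r : ℝ) * e p = e p by ring, e.left_inv hp]
    · rw [c.target]
      rw [show (1 - (r : ℝ)) * e p + (r : ℝ) * e p = e p by ring, e.left_inv hp]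

end Literature.Topology.PlanarFoliations
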